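import Literature.NumberTheory.GaloisRepresentations.RelativeCorestrictionTransitive
import HarnessLib

/-!
# Transport of the corestriction along a homomorphism of pairs inducing a bijection of coset spaces, all degrees
# (`H^q(ψ) ∘ cor_{G₂/S₂} = cor_{G₁/S₁} ∘ H^q(ψ|_{S₁})` — in particular INFLATION COMMUTES WITH CORESTRICTION)

Topic `NumberTheory/GaloisRepresentations`; namespace `Literature.NumberTheory.GaloisRepresentations`. Definitions with bodies (four
transport morphisms) and theorems; no named fact, no instance, no `sorry`.

For profinite groups `G₁`, `G₂`, closed subgroups `S₁ ≤ G₁`, `S₂ ≤ G₂` of finite index, a continuous homomorphism `ψ : G₁ → G₂` with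
`ψ(S₁) ⊆ S₂` such that the induced map of coset spaces `G₁ ⧸ S₁ → G₂ ⧸ S₂` is BIJECTIVE, and a discrete `G₂`-module `M` (`ρ`), pulled back to
`G₁` along `ψ` (`ρ.restrict ψ`): the tree's all-degree corestriction `cor` (`Corestriction.lean`: Shapiro extension followed by the norm of the
coinduced module, Serre I §2.5) satisfies

  `H^q(ψ, id_M) (cor_{S₂ ≤ G₂} w) = cor_{S₁ ≤ G₁} (H^q(ψ|_{S₁}, id_M) w)`     (`map_cor_eq_cor_map_of_bijective`),

i.e. `cor` is natural in morphisms of pairs that are isomorphisms on the coset spaces (NSW I §5 Prop. 1.5.4 / (1.5.6)–(1.5.7), the one-double-coset case;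
Serre I §2.4–2.5 compatible pairs). Two instances: (i) `ψ` injective = the tautological isomorphism of pairs (the tree's `toSubgroupOf_cor`,
`RelativeCorestrictionTransitive.lean`, is the case `ψ = subgroupOfHom`); (ii) `ψ` SURJECTIVE with `S₁ = ψ⁻¹(S₂)` — INFLATION from a quotient
`G₂ = G₁ ⧸ N` (`N ≤ S₁`): `infl ∘ cor = cor ∘ infl` in every degree (`bijective_quotAlong_of_surjective` supplies the hypothesis). The degree-`1`
transfer version with cocycle representatives is the tree's `cores_map_eq_map_cores(_of_forall_exists)`; this file is the all-degree statement for `cor`.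
Proof = the transport pattern of `toSubgroupOf_cor`: the coinduced modules correspond through `Φ(F) = F ∘ ψ` (`coindAlong`), `Φ` intertwines the norms
(`normCoind_coindAlong`: the cosets correspond under `ψ`, each norm term depends only on the coset) and the evaluations at `1`, and every map in sight
is `H^q` of a compatible pair (`map_comp_apply_of`, `extMap_eq_of_shMap_eq`).

Consumer: crux `SmallImageLowerHalfBothSigns` (stmt-BirchSwinnertonDyer-23599), line `rtt_w3`, row S3α brick ρ₂ (the degree-`2` semilocal map):
the inflation `H²(G_P(K_n), X_k) → H²(Gal(K̄/K_n), X_k)` must commute with the corestrictions of the cyclotomic tower (degree `1` is the tree's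
cocycle-level `inflNK_cycLayerCoresO`).

References: [NeukirchSchmidtWingberg2008] I §5 Prop. 1.5.4, (1.5.6)–(1.5.7); [SerreGaloisCohomology1997] I §2.4–§2.5.
-/

noncomputable section

open CategoryTheory Function

universe u

namespace Literature.NumberTheory.GaloisRepresentations

open _root_.TopRep _root_.ContRepresentation _root_.ContinuousCohomology

section Along

variable {G₁ G₂ : Type u} [Group G₁] [TopologicalSpace G₁] [IsTopologicalGroup G₁] [CompactSpace G₁] [T2Space G₁] [TotallyDisconnectedSpace G₁]
  [Group G₂] [TopologicalSpace G₂] [IsTopologicalGroup G₂] [CompactSpace G₂] [T2Space G₂] [TotallyDisconnectedSpace G₂]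
variable (S₁ : Subgroup G₁) (S₂ : Subgroup G₂) [hS₁ : IsClosed (S₁ : Set G₁)] [hS₂ : IsClosed (S₂ : Set G₂)]
variable {M : Type u} [AddCommGroup M] [TopologicalSpace M] [DiscreteTopology M]
variable (ρ : ContinuousRep G₂ ℤ M) (ψ : G₁ →ₜ* G₂) (hψ : ∀ s : S₁, ψ (s : G₁) ∈ S₂)
variable {M₁ : Type u} [AddCommGroup M₁] [TopologicalSpace M₁] [DiscreteTopology M₁] (ρ₁ : ContinuousRep G₁ ℤ M₁)
  (f : TopRep.res (ψ : G₁ →* G₂) ρ.toTopRep ⟶ ρ₁.toTopRep)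

attribute [local instance] compactSpace_of_isClosed_subgroup discreteTopology_coind

/-- The restriction `ψ| : ↥S₁ → ↥S₂` of `ψ`. [cite: SerreGaloisCohomology1997, I §2.4] -/
def subAlong : S₁ →ₜ* S₂ where
  toFun s := ⟨ψ (s : G₁), hψ s⟩
  map_one' := Subtype.ext (map_one ψ)
  map_mul' s t := Subtype.ext (map_mul ψ (s : G₁) (t : G₁))
  continuous_toFun := Continuous.subtype_mk (ψ.continuous.comp continuous_subtype_val) _

omit [IsTopologicalGroup G₁] [CompactSpace G₁] [T2Space G₁] [TotallyDisconnectedSpace G₁] [IsTopologicalGroup G₂] [CompactSpace G₂] [T2Space G₂]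
  [TotallyDisconnectedSpace G₂] hS₁ hS₂ in
/-- `ψ|` on elements. [cite: SerreGaloisCohomology1997, I §2.4] -/
@[simp] theorem subAlong_apply_coe (s : S₁) : ((subAlong S₁ S₂ ψ hψ s : S₂) : G₂) = ψ (s : G₁) := rfl

/-- The induced map of coset spaces `G₁ ⧸ S₁ → G₂ ⧸ S₂`, `c ↦ [ψ c̃]` (on chosen representatives). [cite: NeukirchSchmidtWingberg2008, I §5 (1.5.6)] -/
def quotAlong (c : G₁ ⧸ S₁) : G₂ ⧸ S₂ := QuotientGroup.mk (ψ c.out)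

omit [IsTopologicalGroup G₁] [CompactSpace G₁] [T2Space G₁] [TotallyDisconnectedSpace G₁] [IsTopologicalGroup G₂] [CompactSpace G₂]
  [T2Space G₂] [TotallyDisconnectedSpace G₂] hS₁ hS₂ in
include hψ in
/-- `[ψ g] = quotAlong [g]` for every `g` (the value does not depend on the representative). [cite: NeukirchSchmidtWingberg2008, I §5 (1.5.6)] -/
theorem quotAlong_mk (g : G₁) :
    quotAlong S₁ S₂ ψ (QuotientGroup.mk g) = (QuotientGroup.mk (ψ g) : G₂ ⧸ S₂) := by
  unfold quotAlong
  refine QuotientGroup.eq.2 ?_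
  have hmem : (QuotientGroup.mk g : G₁ ⧸ S₁).out⁻¹ * g ∈ S₁ := QuotientGroup.eq.1 (QuotientGroup.out_eq' _)
  rw [← map_inv, ← map_mul]
  exact hψ ⟨_, hmem⟩

omit [IsTopologicalGroup G₁] [CompactSpace G₁] [T2Space G₁] [TotallyDisconnectedSpace G₁] [IsTopologicalGroup G₂] [CompactSpace G₂]
  [T2Space G₂] [TotallyDisconnectedSpace G₂] hS₁ hS₂ in
include hψ in
/-- **The INFLATION case**: if `ψ` is surjective and `S₁ = ψ⁻¹(S₂)` then `quotAlong` is bijective. [cite: NeukirchSchmidtWingberg2008, I §5 Prop. 1.5.4] -/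
theorem bijective_quotAlong_of_surjective (hsurj : Function.Surjective ψ) (hpre : ∀ g : G₁, ψ g ∈ S₂ → g ∈ S₁) :
    Function.Bijective (quotAlong S₁ S₂ ψ) := by
  constructor
  · intro c c' hcc
    induction c using QuotientGroup.induction_on with
    | H g =>
      induction c' using QuotientGroup.induction_on with
      | H g' =>
        rw [quotAlong_mk S₁ S₂ ψ hψ, quotAlong_mk S₁ S₂ ψ hψ] at hcc
        refine QuotientGroup.eq.2 (hpre _ ?_)
        rw [map_mul, map_inv]
        exact QuotientGroup.eq.1 hcc
  · intro d
    induction d using QuotientGroup.induction_on with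
    | H g₂ =>
      obtain ⟨g₁, rfl⟩ := hsurj g₂
      exact ⟨QuotientGroup.mk g₁, quotAlong_mk S₁ S₂ ψ hψ g₁⟩

/-- The coefficient morphism `f` read over `ψ| : ↥S₁ → ↥S₂` (a morphism `res_{ψ|} M|_{S₂} ⟶ M₁|_{S₁}`). [cite: SerreGaloisCohomology1997, I §2.4] -/
def subAlongMod : TopRep.res (subAlong S₁ S₂ ψ hψ : S₁ →* S₂) (ρ.restrict (subgroupIncl S₂)).toTopRep ⟶ (ρ₁.restrict (subgroupIncl S₁)).toTopRep :=
  TopRep.ofHom ⟨f.hom.toContinuousLinearMap, fun s => by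
    ext m
    exact TopRep.hom_comm_apply f (s : G₁) m⟩

/-- The comparison `τ_{ψ,f} : H^q(S₂, M) → H^q(S₁, M₁)` (pull-back along the compatible pair `(ψ|_{S₁}, f)`). [cite: SerreGaloisCohomology1997, I §2.4] -/
def tauAlong (q : ℕ) :
    continuousCohomology q (ρ.restrict (subgroupIncl S₂)).toTopRep ⟶ continuousCohomology q (ρ₁.restrict (subgroupIncl S₁)).toTopRep :=
  ContinuousCohomology.map (subAlong S₁ S₂ ψ hψ) (subAlongMod S₁ S₂ ρ ψ hψ ρ₁ f) q

omit hS₁ hS₂ [IsTopologicalGroup G₁] [CompactSpace G₁] [T2Space G₁] [TotallyDisconnectedSpace G₁] [T2Space G₂] [TotallyDisconnectedSpace G₂] in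
/-- The equivariance computation behind `coindAlong`: `(F ∘ ψ)(x g) = ((ψ g) F)(ψ x)`. [cite: SerreGaloisCohomology1997, I §2.5] -/
theorem comp_coindRep_apply (g x : G₁) (F : coindModule (ρ.restrict (subgroupIncl S₂))) :
    ((F : coindModule (ρ.restrict (subgroupIncl S₂))) : C(G₂, M)) (ψ (x * g)) =
      (((coindRep (ρ.restrict (subgroupIncl S₂))) (ψ g) F : coindModule (ρ.restrict (subgroupIncl S₂))) : C(G₂, M)) (ψ x) := by
  rw [coindRep_apply_apply, map_mul]

/-- The identity of `M` as a morphism `res_ψ M → M|_ψ` of topological `G₁`-modules (the coefficient part of the inflation `H^q(ψ, id)`; take `ρ₁ = ρ.restrict ψ`,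
`f = idAlong ρ ψ` in `map_cor_eq_cor_map_of_bijective`). [cite: SerreGaloisCohomology1997, I §2.4] -/
def idAlong : TopRep.res (ψ : G₁ →* G₂) ρ.toTopRep ⟶ (ρ.restrict ψ).toTopRep :=
  TopRep.ofHom ⟨ContinuousLinearMap.id ℤ M, fun _ => rfl⟩

/-- **`Φ : M_{G₂}^{S₂}(M) → M_{G₁}^{S₁}(M₁)`, `Φ(F) = f ∘ F ∘ ψ`** — transport of the coinduced module along the compatible pair `(ψ, f)`, a morphism of topological
modules over `ψ`. [cite: SerreGaloisCohomology1997, I §2.5] -/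
def coindAlong :
    TopRep.res (ψ : G₁ →* G₂) (coindRep (ρ.restrict (subgroupIncl S₂))).toTopRep ⟶ (coindRep (ρ₁.restrict (subgroupIncl S₁))).toTopRep :=
  TopRep.ofHom
    { toLinearMap :=
        { toFun := fun F => ⟨(f.hom : C(M, M₁)).comp ((((F : coindModule (ρ.restrict (subgroupIncl S₂))) : C(G₂, M)).comp ψ.toContinuousMap)),
              fun s x => by
                have h := (mem_coind_iff (ρ.restrict (subgroupIncl S₂)) _).1 (F : coindModule (ρ.restrict (subgroupIncl S₂))).2
                  (subAlong S₁ S₂ ψ hψ s) (ψ x)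
                change f.hom (((F : coindModule (ρ.restrict (subgroupIncl S₂))) : C(G₂, M)) (ψ ((s : G₁) * x))) = _
                rw [map_mul]
                change f.hom (((F : coindModule (ρ.restrict (subgroupIncl S₂))) : C(G₂, M)) ((subAlong S₁ S₂ ψ hψ s : G₂) * ψ x)) = _
                rw [h]
                exact TopRep.hom_comm_apply f (s : G₁) _⟩
          map_add' := fun F F' => Subtype.ext (ContinuousMap.ext fun x => map_add f.hom _ _)
          map_smul' := fun c F => Subtype.ext (ContinuousMap.ext fun x => map_zsmul f.hom c _) }
      cont := continuous_of_discreteTopology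
      isIntertwining' := fun g => by
        refine ContinuousLinearMap.ext fun F => Subtype.ext (ContinuousMap.ext fun x => ?_)
        exact congrArg f.hom (comp_coindRep_apply S₂ ρ ψ g x F).symm }

omit [T2Space G₁] [TotallyDisconnectedSpace G₁] [T2Space G₂] [TotallyDisconnectedSpace G₂] hS₁ hS₂ in
/-- `Φ` on elements: `Φ(F)(x) = f (F (ψ x))`. [cite: SerreGaloisCohomology1997, I §2.5] -/
@[simp] theorem coindAlong_coe_apply (F : coindModule (ρ.restrict (subgroupIncl S₂))) (x : G₁) :
    (((coindAlong S₁ S₂ ρ ψ hψ ρ₁ f).hom F : coindModule (ρ₁.restrict (subgroupIncl S₁))) : C(G₁, M₁)) x =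
      f.hom (((F : coindModule (ρ.restrict (subgroupIncl S₂))) : C(G₂, M)) (ψ x)) := rfl

/-- The norm `N_{G₂/S₂}` followed by `f`, read over `ψ` (a morphism along `ψ` into `M₁`). [cite: SerreGaloisCohomology1997, I §2.5] -/
def normAlong [Fintype (G₂ ⧸ S₂)] :
    TopRep.res (ψ : G₁ →* G₂) (coindRep (ρ.restrict (subgroupIncl S₂))).toTopRep ⟶ ρ₁.toTopRep :=
  TopRep.ofHom
    { toLinearMap := f.hom.toLinearMap.comp (normCoind (S := S₂) ρ).hom.toLinearMap
      cont := continuous_of_discreteTopology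
      isIntertwining' := fun s => by
        ext F
        have hN := TopRep.hom_comm_apply (normCoind (S := S₂) ρ) (ψ s) F
        exact (congrArg f.hom hN).trans (TopRep.hom_comm_apply f s _) }

omit [T2Space G₁] [TotallyDisconnectedSpace G₁] [T2Space G₂] [TotallyDisconnectedSpace G₂] hS₁ hS₂ in
/-- **`Φ` intertwines the norms**: `N_{G₁/S₁}(Φ F) = f (N_{G₂/S₂}(F))` when the cosets correspond under `ψ` (each norm term depends only on the coset, `f` is
equivariant along `ψ`). [cite: SerreGaloisCohomology1997, I §2.5] [cite: NeukirchSchmidtWingberg2008, I §5 (1.5.6)–(1.5.7)] -/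
theorem normCoind_coindAlong [Fintype (G₂ ⧸ S₂)] [Fintype (G₁ ⧸ S₁)] (hbij : Function.Bijective (quotAlong S₁ S₂ ψ))
    (F : coindModule (ρ.restrict (subgroupIncl S₂))) :
    (normCoind (S := S₁) ρ₁).hom ((coindAlong S₁ S₂ ρ ψ hψ ρ₁ f).hom F) = f.hom ((normCoind (S := S₂) ρ).hom F) := by
  rw [normCoind_hom_apply, normCoind_hom_apply, map_sum]
  have hterm : ∀ c : G₁ ⧸ S₁,
      ρ₁ c.out ((((coindAlong S₁ S₂ ρ ψ hψ ρ₁ f).hom F : coindModule (ρ₁.restrict (subgroupIncl S₁))) : C(G₁, M₁)) c.out⁻¹) =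
        f.hom (normTerm ρ F (ψ c.out)) := fun c ↦ by
    unfold normTerm
    rw [← map_inv, coindAlong_coe_apply]
    exact (TopRep.hom_comm_apply f c.out _).symm
  simp_rw [hterm]
  exact Fintype.sum_bijective _ hbij _ _ fun c ↦ congrArg f.hom (normTerm_eq_of_coe_eq ρ F (QuotientGroup.out_eq' (quotAlong S₁ S₂ ψ c)).symm)

omit [IsTopologicalGroup G₁] [CompactSpace G₁] [T2Space G₁] [TotallyDisconnectedSpace G₁] [T2Space G₂] [TotallyDisconnectedSpace G₂] hS₁ hS₂ in
include hψ in
/-- The equivariance computation behind `evalAlong`: `((ψ s)·F)(ψ 1) = (ψ s) · F(ψ 1)` for `s ∈ S₁`. [cite: SerreGaloisCohomology1997, I §2.5] -/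
theorem coindRep_apply_subAlong_one (s : S₁) (F : coindModule (ρ.restrict (subgroupIncl S₂))) :
    (((coindRep (ρ.restrict (subgroupIncl S₂))) (ψ (s : G₁)) F : coindModule (ρ.restrict (subgroupIncl S₂))) : C(G₂, M)) (ψ 1) =
      ρ (ψ (s : G₁)) (((F : coindModule (ρ.restrict (subgroupIncl S₂))) : C(G₂, M)) (ψ 1)) := by
  have hF := (mem_coind_iff (ρ.restrict (subgroupIncl S₂)) _).1 (F : coindModule (ρ.restrict (subgroupIncl S₂))).2 (subAlong S₁ S₂ ψ hψ s) 1
  rw [mul_one] at hF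
  rw [coindRep_apply_apply, map_one, one_mul]
  exact hF

/-- The evaluation `F ↦ Φ(F)(1) = f (F(ψ 1))` along `χ = ψ ∘ incl_{S₁} : ↥S₁ → G₂` (the Shapiro evaluation of `M_{G₁}^{S₁}` after `Φ`). [cite: SerreGaloisCohomology1997, I §2.5] -/
def evalAlong :
    TopRep.res ((ψ.comp (subgroupIncl S₁) : S₁ →ₜ* G₂) : S₁ →* G₂) (coindRep (ρ.restrict (subgroupIncl S₂))).toTopRep ⟶
      (ρ₁.restrict (subgroupIncl S₁)).toTopRep :=
  TopRep.ofHom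
    { toLinearMap := (coindEvalOne (ρ₁.restrict (subgroupIncl S₁))).hom.toLinearMap.comp (coindAlong S₁ S₂ ρ ψ hψ ρ₁ f).hom.toLinearMap
      cont := continuous_of_discreteTopology
      isIntertwining' := fun s => by
        ext F
        change f.hom ((((coindRep (ρ.restrict (subgroupIncl S₂))) (ψ (s : G₁)) F : coindModule (ρ.restrict (subgroupIncl S₂))) : C(G₂, M)) (ψ 1)) =
          ρ₁ (s : G₁) (f.hom (((F : coindModule (ρ.restrict (subgroupIncl S₂))) : C(G₂, M)) (ψ 1)))
        rw [coindRep_apply_subAlong_one S₁ S₂ ρ ψ hψ s F]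
        exact TopRep.hom_comm_apply f (s : G₁) _ }

/-- ★★ **NATURALITY OF `cor` IN COMPATIBLE PAIRS BIJECTIVE ON COSETS, ALL DEGREES**: for `w ∈ H^q(S₂, M)`,
`H^q(ψ, f) (cor_{S₂ ≤ G₂} w) = cor_{S₁ ≤ G₁} (H^q(ψ|_{S₁}, f) w)` in `H^q(G₁, M₁)` (`cor = H(norm) ∘ sh⁻¹`; `Φ` intertwines `sh` and the norms; `map_comp_apply_of`).
With `ψ` surjective, `S₁ = ψ⁻¹ S₂` and `f` the identity of `M` (`bijective_quotAlong_of_surjective`): INFLATION COMMUTES WITH CORESTRICTION in every degree.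
[cite: NeukirchSchmidtWingberg2008, I §5 Prop. 1.5.4, (1.5.6)–(1.5.7)] [cite: SerreGaloisCohomology1997, I §2.4–§2.5] -/
theorem map_cor_eq_cor_map_of_bijective [Fintype (G₂ ⧸ S₂)] [Fintype (G₁ ⧸ S₁)] (hbij : Function.Bijective (quotAlong S₁ S₂ ψ)) (q : ℕ)
    (w : continuousCohomology q (ρ.restrict (subgroupIncl S₂)).toTopRep) :
    ContinuousCohomology.map ψ f q (cor S₂ ρ q w) = cor S₁ ρ₁ q (tauAlong S₁ S₂ ρ ψ hψ ρ₁ f q w) := by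
  set e := extMap S₂ ρ q w with he
  -- step 1: `H^q(ψ, f) ∘ H(N₂) = H^q(ψ, f ∘ N₂)`
  have h1 : ContinuousCohomology.map ψ f q (cohomologyMap (normCoind (S := S₂) ρ) q e) =
      ContinuousCohomology.map ψ (normAlong S₂ ρ ψ ρ₁ f) q e :=
    (map_comp_apply_of (ContinuousMonoidHom.id G₂) ψ ψ (fun _ => rfl) (resIdHom (normCoind (S := S₂) ρ))
      (X := (coindRep (ρ.restrict (subgroupIncl S₂))).toTopRep) (Y := ρ.toTopRep) (Z := ρ₁.toTopRep)
      f (normAlong S₂ ρ ψ ρ₁ f) (fun _ => rfl) q e).symm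
  -- step 2: `H^q(ψ, f ∘ N₂) = H(N₁) ∘ H^q(ψ, Φ)`
  have h2 : ContinuousCohomology.map ψ (normAlong S₂ ρ ψ ρ₁ f) q e =
      cohomologyMap (normCoind (S := S₁) ρ₁) q (ContinuousCohomology.map ψ (coindAlong S₁ S₂ ρ ψ hψ ρ₁ f) q e) :=
    map_comp_apply_of ψ (ContinuousMonoidHom.id _) ψ (fun _ => rfl) (coindAlong S₁ S₂ ρ ψ hψ ρ₁ f) (resIdHom (normCoind (S := S₁) ρ₁))
      (normAlong S₂ ρ ψ ρ₁ f) (fun F => (normCoind_coindAlong S₁ S₂ ρ ψ hψ ρ₁ f hbij F).symm) q e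
  -- step 3: `H^q(ψ, Φ) (ext w) = ext (τ w)` (checked after `sh`, which is injective)
  have h3 : ContinuousCohomology.map ψ (coindAlong S₁ S₂ ρ ψ hψ ρ₁ f) q e = extMap S₁ ρ₁ q (tauAlong S₁ S₂ ρ ψ hψ ρ₁ f q w) := by
    symm
    refine extMap_eq_of_shMap_eq S₁ ρ₁ q ?_
    let χ : S₁ →ₜ* G₂ := ψ.comp (subgroupIncl S₁)
    let H := evalAlong S₁ S₂ ρ ψ hψ ρ₁ f
    have a : shMap S₁ ρ₁ q (ContinuousCohomology.map ψ (coindAlong S₁ S₂ ρ ψ hψ ρ₁ f) q e) = ContinuousCohomology.map χ H q e :=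
      (map_comp_apply_of ψ (subgroupIncl S₁) χ (fun _ => rfl) (coindAlong S₁ S₂ ρ ψ hψ ρ₁ f)
        (coindEvalOne (ρ₁.restrict (subgroupIncl S₁))) H (fun _ => rfl) q e).symm
    have b : tauAlong S₁ S₂ ρ ψ hψ ρ₁ f q w = ContinuousCohomology.map χ H q e := by
      rw [← sh_extMap S₂ ρ q w, ← he]
      exact (map_comp_apply_of (subgroupIncl S₂) (subAlong S₁ S₂ ψ hψ) χ (fun _ => rfl)
        (coindEvalOne (ρ.restrict (subgroupIncl S₂))) (subAlongMod S₁ S₂ ρ ψ hψ ρ₁ f) H (fun F => by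
          change f.hom (((F : coindModule (ρ.restrict (subgroupIncl S₂))) : C(G₂, M)) (ψ 1)) =
            f.hom (((F : coindModule (ρ.restrict (subgroupIncl S₂))) : C(G₂, M)) 1)
          rw [map_one]) q e).symm
    rw [a, b]
  rw [cor_apply, ← he, h1, h2, h3, ← cor_apply]

end Along


/-! ### The relative form: `relCor` is natural in compatible pairs of towers -/

section RelCorAlong

variable {Γ₁ Γ₂ : Type u} [Group Γ₁] [TopologicalSpace Γ₁] [IsTopologicalGroup Γ₁] [CompactSpace Γ₁] [T2Space Γ₁] [TotallyDisconnectedSpace Γ₁]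
  [Group Γ₂] [TopologicalSpace Γ₂] [IsTopologicalGroup Γ₂] [CompactSpace Γ₂] [T2Space Γ₂] [TotallyDisconnectedSpace Γ₂]
variable (V₁ V₁' : Subgroup Γ₁) (V₂ V₂' : Subgroup Γ₂) [hV₁ : IsClosed (V₁ : Set Γ₁)] [hV₁' : IsClosed (V₁' : Set Γ₁)]
  [hV₂ : IsClosed (V₂ : Set Γ₂)] [hV₂' : IsClosed (V₂' : Set Γ₂)]
variable {M : Type u} [AddCommGroup M] [TopologicalSpace M] [DiscreteTopology M] (ρ : ContinuousRep Γ₂ ℤ M)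
  {M₁ : Type u} [AddCommGroup M₁] [TopologicalSpace M₁] [DiscreteTopology M₁] (ρ₁ : ContinuousRep Γ₁ ℤ M₁)
  (ψ₀ : Γ₁ →ₜ* Γ₂) (f₀ : TopRep.res (ψ₀ : Γ₁ →* Γ₂) ρ.toTopRep ⟶ ρ₁.toTopRep)
  (h₁ : V₁' ≤ V₁) (h₂ : V₂' ≤ V₂) (hV : ∀ v : V₁, ψ₀ (v : Γ₁) ∈ V₂) (hV' : ∀ v : V₁', ψ₀ (v : Γ₁) ∈ V₂')

attribute [local instance] compactSpace_of_isClosed_subgroup discreteTopology_coind isClosed_subgroupOf_of_isClosed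

omit [IsTopologicalGroup Γ₁] [CompactSpace Γ₁] [T2Space Γ₁] [TotallyDisconnectedSpace Γ₁] [IsTopologicalGroup Γ₂] [CompactSpace Γ₂] [T2Space Γ₂]
  [TotallyDisconnectedSpace Γ₂] hV₁ hV₁' hV₂ hV₂' in
include hV' in
/-- `ψ₀|_{V₁}` maps the copy of `V₁'` inside `↥V₁` into the copy of `V₂'` inside `↥V₂`. [cite: SerreGaloisCohomology1997, I §2.4] -/
theorem subAlong_mem_subgroupOf (s : (V₁'.subgroupOf V₁ : Subgroup V₁)) : subAlong V₁ V₂ ψ₀ hV (s : V₁) ∈ V₂'.subgroupOf V₂ :=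
  hV' ⟨((s : V₁) : Γ₁), s.2⟩

/-- ★★ **`relCor` IS NATURAL IN COMPATIBLE PAIRS OF TOWERS, ALL DEGREES**: for closed `V₁' ≤ V₁ ≤ Γ₁`, `V₂' ≤ V₂ ≤ Γ₂` of finite indices, a continuous `ψ₀ : Γ₁ → Γ₂`
with `ψ₀(V₁) ⊆ V₂`, `ψ₀(V₁') ⊆ V₂'` inducing a BIJECTION `V₁/V₁' → V₂/V₂'`, and a compatible coefficient morphism `f₀ : M → M₁` over `ψ₀`:
`H^q(ψ₀|_{V₁}, f₀) ∘ cor_{V₂/V₂'} = cor_{V₁/V₁'} ∘ H^q(ψ₀|_{V₁'}, f₀)`. Typical use: `ψ₀ : Γ_K ↠ G_S = Γ_K ⧸ N_S` with `N_S ≤ V₁'` (INFLATION from the restricted-ramification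
levels `H^q(G_S(K_n), X^{N_S})` to `H^q(Gal(K̄/K_n), X)` commutes with the corestrictions of the tower), or `ψ₀` the inclusion of a decomposition group totally
ramified in the tower. [cite: NeukirchSchmidtWingberg2008, I §5 Prop. 1.5.4, (1.5.6)–(1.5.7)] [cite: SerreGaloisCohomology1997, I §2.4–§2.5] -/
theorem map_relCor_eq_relCor_map_of_bijective [Fintype (V₂ ⧸ V₂'.subgroupOf V₂)] [Fintype (V₁ ⧸ V₁'.subgroupOf V₁)]
    (hbij : Function.Bijective (quotAlong (V₁'.subgroupOf V₁) (V₂'.subgroupOf V₂) (subAlong V₁ V₂ ψ₀ hV))) (q : ℕ)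
    (z : continuousCohomology q (ρ.restrict (subgroupIncl V₂')).toTopRep) :
    ContinuousCohomology.map (subAlong V₁ V₂ ψ₀ hV) (subAlongMod V₁ V₂ ρ ψ₀ hV ρ₁ f₀) q (relCor V₂ V₂' ρ h₂ q z) =
      relCor V₁ V₁' ρ₁ h₁ q (ContinuousCohomology.map (subAlong V₁' V₂' ψ₀ hV') (subAlongMod V₁' V₂' ρ ψ₀ hV' ρ₁ f₀) q z) := by
  rw [relCor_apply, relCor_apply, map_cor_eq_cor_map_of_bijective (V₁'.subgroupOf V₁) (V₂'.subgroupOf V₂) (ρ.restrict (subgroupIncl V₂))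
    (subAlong V₁ V₂ ψ₀ hV) (subAlong_mem_subgroupOf V₁ V₁' V₂ V₂' ψ₀ hV hV') (ρ₁.restrict (subgroupIncl V₁)) (subAlongMod V₁ V₂ ρ ψ₀ hV ρ₁ f₀) hbij q]
  congr 1
  -- both sides are `H^q` of the compatible pair `(χ, f₀)` along `χ : V₁'.subgroupOf V₁ → V₂'`
  let χ : (V₁'.subgroupOf V₁ : Subgroup V₁) →ₜ* V₂' := (subAlong V₁' V₂' ψ₀ hV').comp (subgroupOfHom h₁)
  let H : TopRep.res (χ : (V₁'.subgroupOf V₁ : Subgroup V₁) →* V₂') (ρ.restrict (subgroupIncl V₂')).toTopRep ⟶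
      ((ρ₁.restrict (subgroupIncl V₁)).restrict (subgroupIncl (V₁'.subgroupOf V₁))).toTopRep :=
    TopRep.ofHom ⟨f₀.hom.toContinuousLinearMap, fun s => by
      ext m
      exact TopRep.hom_comm_apply f₀ (((s : (V₁'.subgroupOf V₁ : Subgroup V₁)) : V₁) : Γ₁) m⟩
  have e1 : tauAlong (V₁'.subgroupOf V₁) (V₂'.subgroupOf V₂) (ρ.restrict (subgroupIncl V₂)) (subAlong V₁ V₂ ψ₀ hV)
      (subAlong_mem_subgroupOf V₁ V₁' V₂ V₂' ψ₀ hV hV') (ρ₁.restrict (subgroupIncl V₁)) (subAlongMod V₁ V₂ ρ ψ₀ hV ρ₁ f₀) q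
      (toSubgroupOf ρ.toTopRep h₂ q z) = ContinuousCohomology.map χ H q z :=
    (map_comp_apply_of (subgroupOfHom h₂) (subAlong (V₁'.subgroupOf V₁) (V₂'.subgroupOf V₂) (subAlong V₁ V₂ ψ₀ hV)
      (subAlong_mem_subgroupOf V₁ V₁' V₂ V₂' ψ₀ hV hV')) χ (fun _ => rfl) (X := (ρ.restrict (subgroupIncl V₂')).toTopRep)
      (Y := ((ρ.restrict (subgroupIncl V₂)).restrict (subgroupIncl (V₂'.subgroupOf V₂))).toTopRep)
      (Z := ((ρ₁.restrict (subgroupIncl V₁)).restrict (subgroupIncl (V₁'.subgroupOf V₁))).toTopRep)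
      (TopRep.ofHom ⟨ContinuousLinearMap.id ℤ M, fun _ => rfl⟩)
      (subAlongMod (V₁'.subgroupOf V₁) (V₂'.subgroupOf V₂) (ρ.restrict (subgroupIncl V₂)) (subAlong V₁ V₂ ψ₀ hV)
        (subAlong_mem_subgroupOf V₁ V₁' V₂ V₂' ψ₀ hV hV') (ρ₁.restrict (subgroupIncl V₁)) (subAlongMod V₁ V₂ ρ ψ₀ hV ρ₁ f₀)) H
      (fun _ => rfl) q z).symm
  have e2 : toSubgroupOf ρ₁.toTopRep h₁ q (ContinuousCohomology.map (subAlong V₁' V₂' ψ₀ hV') (subAlongMod V₁' V₂' ρ ψ₀ hV' ρ₁ f₀) q z) =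
      ContinuousCohomology.map χ H q z :=
    (map_comp_apply_of (subAlong V₁' V₂' ψ₀ hV') (subgroupOfHom h₁) χ (fun _ => rfl) (X := (ρ.restrict (subgroupIncl V₂')).toTopRep)
      (Y := (ρ₁.restrict (subgroupIncl V₁')).toTopRep) (Z := ((ρ₁.restrict (subgroupIncl V₁)).restrict (subgroupIncl (V₁'.subgroupOf V₁))).toTopRep)
      (subAlongMod V₁' V₂' ρ ψ₀ hV' ρ₁ f₀) (TopRep.ofHom ⟨ContinuousLinearMap.id ℤ M₁, fun _ => rfl⟩) H (fun _ => rfl) q z).symm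
  rw [e1, e2]

end RelCorAlong

end Literature.NumberTheory.GaloisRepresentations

end
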